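import Literature.NumberTheory.Sieve.MoebiusWalshCircuitsProofs
import Literature.NumberTheory.LFunctions.LiouvilleSumExpSqrtBound
import Literature.Computability.Complexity.ACFourierTails
import HarnessLib

/-!
# Green 2012, Theorem 1 for the Liouville function: the reduction to Proposition 1 (§2), proved

Topic `Literature/NumberTheory/Sieve`; second proofs companion of `MoebiusWalshCircuits.lean` (the
first, `MoebiusWalshCircuitsProofs.lean`, holds the digit/Walsh-sum bridges reused here).
Everything here is PROVED (theorems only, no definition, no named fact).

B. Green, *On (not) computing the Möbius function using bounded depth circuits*, Combin. Probab.
Comput. 21 (2012) 942–951 (arXiv:1103.4991), §2 ("A result of Linial, Mansour and Nisan"), deduces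
Theorem 1 (`𝔼 μ(x)F(x) = o(1)` for `F ∈ AC⁰(d)`) from two inputs: Theorem 2 (Linial–Mansour–Nisan:
the Fourier tail `∑_{|S|>t} F̂(S)²` of a depth-`d` size-`M` circuit is `≤ 2M 2^{-t^{1/d}/20}`) and
Proposition 1 (`|μ̂(S)| ≪ k e^{-c√n/k}` for `|S| = k`), by expanding `𝔼 μF = ∑_S μ̂(S)F̂(S)`, using
the trivial bound `|F̂(S)| ≤ 1` on the small characters and Cauchy–Schwarz with Parseval on the
tail; p. 3: "All of the results in this paper hold equally well for the Liouville function".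

This file formalises exactly that deduction for `λ` in the conventions of the named fact
`Literature.NumberTheory.Sieve.green_liouville_AC0` (tree class `AC⁰`: `Circuit.acDepth` with
negations free, polynomial size, `ε`-form eventually in `n`):

* `Literature.NumberTheory.Sieve.green_liouville_AC0_of_fourierWalsh` —
  `LFunctions.green_liouville_fourierWalsh → green_liouville_AC0`: Green's Theorem 1 for `λ`
  (qualitative form) from Green's Proposition 1 for `λ` (the named fact
  `Literature.NumberTheory.LFunctions.green_liouville_fourierWalsh` of
  `Literature/NumberTheory/LFunctions/MoebiusWalshCircuits.lean`).

The two other inputs of §2 are theorems of the tree: in place of Linial–Mansour–Nisan we use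
A. Tal's Fourier-tail bound (`Literature.Computability.Complexity.ACForm.tailWeight_le_tailBound`,
Tal 2017 Thm. 3.6, through `Circuit.exists_acForm`, which absorbs the free negations and the
`acDepth` convention of the tree's `AC⁰` — so no De Morgan preprocessing is needed), and for the
empty character `S = ∅` (`λ̂(∅) = 𝔼 λ`, "the most trivial case `F ≡ 1` is equivalent to the prime
number theorem", Green p. 1) the tree's `∑_{n ≤ x} λ(n) ≪ x e^{-c√log x}`
(`Literature.NumberTheory.LFunctions.abs_sum_liouville_le_mul_exp_neg_sqrt_log`).

## The argument (Green §2, with the level `k ≍ n^{1/8}` in place of `n^{1/6}`)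

* `MoebiusWalsh.sum_range_two_pow_eq_sum_cube` (`MoebiusWalshCircuitsProofs.lean`): `x < 2ⁿ ↔` digit
  vectors `Fin n → Bool` (reindexing `∑_{x < 2ⁿ}` over the cube by the binary digits of `x`).
* `GreenAC0.sum_mul_eq_sum_coeff_mul`, `GreenAC0.sum_sq_sum_mul_walsh`: `∑_y G f = ∑_S f̂(S)·(∑_y Gχ_S)`
  and Parseval for the Walsh sums (O'Donnell §1.4; tree `BooleanFourier.lean`).
* `GreenAC0.core_bound`: `|∑ G f| ≤ E₀ + (n+1)^k E₁ + 2ⁿ√τ` from `|∑ G| ≤ E₀`, `|∑ Gχ_S| ≤ E₁`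
  (`1 ≤ |S| ≤ k`; there are `≤ (n+1)^k` such `S`, `GreenAC0.card_filter_card_le`) and
  `W^{≥k+1}[f] ≤ τ`.
* `GreenAC0.tailWeight_circuit_le` (Tal), `GreenAC0.walsh_liouville_le` (Proposition 1, uniform in
  `|S| ≤ k`), `GreenAC0.abs_sum_liouville_cube_le_eventually` (PNT along `N = 2ⁿ`).
* Parameters: `k = Nat.sqrt (Nat.sqrt (Nat.sqrt n)) = ⌊n^{1/8}⌋` (iterated `Nat.sqrt`, `k⁸ ≤ n < (k+1)⁸`); the small characters
  cost `(n+1)^k K k e^{-c√n/k} ≤ K e^{9k² - ck³} → 0` (`GreenAC0.low_term_eventually`), the tail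
  `8^{d+2} exp(-(k+1) ln 2/(B^{d+2} ℓ^d))` with `ℓ = ⌊log₂(2s+1)⌋ ≤ 8(deg p + 1)(log₂(k+1) + 1)` tends
  to `0` because `(j+1)^d/2^j → 0` (`GreenAC0.tail_term_eventually`).

## References

* B. Green, Combin. Probab. Comput. 21 (2012) 942–951, Theorem 1, §2, p. 3 [Green2012].
* A. Tal, *Tight bounds on the Fourier spectrum of AC⁰*, CCC 2017, Theorem 3.6 [Tal2017].
* R. O'Donnell, *Analysis of Boolean Functions*, CUP 2014, §1.4 [ODonnell2014].
* G. Greaves, *Sieves in Number Theory*, Springer 2001, §4.5.1 (1.2) [Greaves2001].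
-/

noncomputable section

open Filter Finset Real Topology
open Literature.Computability.Complexity
open Literature.Computability.Complexity.LowDegree
open Literature.Probability.RandomGraphs.LowDegree

namespace Literature.NumberTheory.Sieve

namespace GreenAC0

variable {n : ℕ}

/-! ### Fourier–Walsh expansion of a correlation `∑_y G(y) f(y)` -/

/-- The Walsh sum of `LFunctions.walshSum` in the vocabulary of `LowDegree.walsh`. [folklore] -/
theorem walshSum_eq (g : ℕ → ℤ) (S : Finset (Fin n)) :
    Literature.NumberTheory.LFunctions.walshSum g S = ∑ y : Fin n → Bool, (g (bitsToNat (List.ofFn y)) : ℝ) * walsh S y := by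
  unfold Literature.NumberTheory.LFunctions.walshSum walsh sgn
  rfl

/-- `∑_y G(y) χ_S(y) = 2^n Ĝ(S)`. [folklore] -/
theorem sum_mul_walsh_eq (G : (Fin n → Bool) → ℝ) (S : Finset (Fin n)) :
    ∑ y, G y * walsh S y = 2 ^ n * cubeFourierCoeff G S := by
  rw [cubeFourierCoeff, mul_div_cancel₀ _ (by positivity)]

/-- **Plancherel on the cube**: `∑_y G(y) f(y) = ∑_S f̂(S) · ∑_y G(y) χ_S(y)`. [cite: ODonnell2014, §1.4] -/
theorem sum_mul_eq_sum_coeff_mul (G f : (Fin n → Bool) → ℝ) :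
    ∑ y, G y * f y = ∑ S : Finset (Fin n), cubeFourierCoeff f S * ∑ y, G y * walsh S y := by
  calc ∑ y, G y * f y = ∑ y, G y * ∑ S, cubeFourierCoeff f S * walsh S y := by
        simp_rw [sum_cubeFourierCoeff_mul_walsh]
    _ = ∑ y, ∑ S, cubeFourierCoeff f S * (G y * walsh S y) := by
        refine Finset.sum_congr rfl fun y _ => ?_
        rw [Finset.mul_sum]
        exact Finset.sum_congr rfl fun S _ => by ring
    _ = ∑ S, ∑ y, cubeFourierCoeff f S * (G y * walsh S y) := Finset.sum_comm
    _ = _ := by simp_rw [Finset.mul_sum]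

/-- **Parseval for the Walsh sums**: `∑_S (∑_y G χ_S)² = 2^n ∑_y G(y)²`. [cite: ODonnell2014, §1.4] -/
theorem sum_sq_sum_mul_walsh (G : (Fin n → Bool) → ℝ) :
    ∑ S : Finset (Fin n), (∑ y, G y * walsh S y) ^ 2 = 2 ^ n * ∑ y, G y ^ 2 := by
  simp_rw [sum_mul_walsh_eq, mul_pow, ← Finset.mul_sum, sum_cubeFourierCoeff_sq]
  have h2 : (2 : ℝ) ^ n ≠ 0 := by positivity
  field_simp

/-- `χ_∅ = 1`. [folklore] -/
theorem walsh_empty (y : Fin n → Bool) : walsh (∅ : Finset (Fin n)) y = 1 := by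
  simp [walsh]

/-! ### Counting the small Walsh characters -/

/-- `∑_{ℓ ≤ k} n^ℓ ≤ (n+1)^k`. [folklore] -/
theorem sum_range_pow_le (n k : ℕ) : ∑ ℓ ∈ range (k + 1), n ^ ℓ ≤ (n + 1) ^ k := by
  induction k with
  | zero => simp
  | succ k ih =>
      rw [Finset.sum_range_succ]
      have h1 : n ^ (k + 1) ≤ (n + 1) ^ k * n := by
        rw [pow_succ]
        exact Nat.mul_le_mul_right n (Nat.pow_le_pow_left (Nat.le_succ n) k)
      calc ∑ ℓ ∈ range (k + 1), n ^ ℓ + n ^ (k + 1) ≤ (n + 1) ^ k + (n + 1) ^ k * n := add_le_add ih h1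
        _ = (n + 1) ^ (k + 1) := by ring

/-- The number of `S ⊆ {0,…,n-1}` with `|S| ≤ k` is at most `(n+1)^k`. [folklore] -/
theorem card_filter_card_le (n k : ℕ) :
    ((univ : Finset (Finset (Fin n))).filter fun S => S.card ≤ k).card ≤ (n + 1) ^ k := by
  have hsub : ((univ : Finset (Finset (Fin n))).filter fun S => S.card ≤ k) ⊆
      (range (k + 1)).biUnion fun ℓ => univ.powersetCard ℓ := by
    intro S hS
    simp only [Finset.mem_filter, Finset.mem_univ, true_and] at hS
    simp only [Finset.mem_biUnion, Finset.mem_range, Finset.mem_powersetCard, Finset.subset_univ, true_and]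
    exact ⟨S.card, by omega, rfl⟩
  refine (Finset.card_le_card hsub).trans ((Finset.card_biUnion_le).trans ?_)
  refine le_trans ?_ (sum_range_pow_le n k)
  refine Finset.sum_le_sum fun ℓ _ => ?_
  rw [Finset.card_powersetCard, Finset.card_univ, Fintype.card_fin]
  exact Nat.choose_le_pow n ℓ

/-! ### The core inequality (Green 2012, §2, with an abstract tail bound) -/

/-- **Green's §2 argument, abstract form.** If `|f|, |G| ≤ 1` on the cube, `|∑ G| ≤ E₀`, all Walsh
sums `∑_y G χ_S` with `1 ≤ |S| ≤ k` are `≤ E₁` in absolute value, and the Fourier tail of `f` above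
level `k` is `≤ τ`, then `|∑_y G(y) f(y)| ≤ E₀ + (n+1)^k E₁ + 2^n √τ` (expansion in the Walsh
basis; trivial bound `|f̂(S)| ≤ 1` on the `≤ (n+1)^k` small characters; Cauchy–Schwarz and Parseval
on the tail). [cite: Green2012, §2] -/
theorem core_bound {k : ℕ} (f G : (Fin n → Bool) → ℝ) (hf : ∀ y, |f y| ≤ 1) (hG : ∀ y, |G y| ≤ 1)
    {E₀ E₁ τ : ℝ} (hE₁ : 0 ≤ E₁) (h0 : |∑ y, G y| ≤ E₀)
    (h1 : ∀ S : Finset (Fin n), 1 ≤ S.card → S.card ≤ k → |∑ y, G y * walsh S y| ≤ E₁)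
    (hτ : tailWeight f (k + 1) ≤ τ) :
    |∑ y, G y * f y| ≤ E₀ + (n + 1) ^ k * E₁ + 2 ^ n * Real.sqrt τ := by
  classical
  set W : Finset (Fin n) → ℝ := fun S => ∑ y, G y * walsh S y with hW
  set a : Finset (Fin n) → ℝ := fun S => cubeFourierCoeff f S with ha
  have hexp : ∑ y, G y * f y = ∑ S, a S * W S := sum_mul_eq_sum_coeff_mul G f
  rw [hexp]
  set low := (univ : Finset (Finset (Fin n))).filter fun S => S.card ≤ k with hlow
  set high := (univ : Finset (Finset (Fin n))).filter fun S => ¬ S.card ≤ k with hhigh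
  have hsplit := (Finset.sum_filter_add_sum_filter_not univ (fun S : Finset (Fin n) => S.card ≤ k)
    (fun S => a S * W S))
  -- the empty set
  have h0mem : (∅ : Finset (Fin n)) ∈ low := by simp [hlow]
  have hlow_split := Finset.add_sum_erase low (fun S => a S * W S) h0mem
  have hdecomp : ∑ S, a S * W S = a ∅ * W ∅ + ∑ S ∈ low.erase ∅, a S * W S + ∑ S ∈ high, a S * W S := by
    rw [hlow_split]; exact hsplit.symm
  rw [hdecomp]
  have habs_a : ∀ S, |a S| ≤ 1 := fun S => abs_cubeFourierCoeff_le_one f hf S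
  have hW0 : W ∅ = ∑ y, G y := by
    simp only [hW, walsh_empty, mul_one]
  have hT0 : |a ∅ * W ∅| ≤ E₀ := by
    rw [abs_mul, hW0]
    calc |a ∅| * |∑ y, G y| ≤ 1 * E₀ :=
          mul_le_mul (habs_a ∅) h0 (abs_nonneg _) zero_le_one
      _ = E₀ := one_mul _
  -- the small nonempty characters
  have hT1 : |∑ S ∈ low.erase ∅, a S * W S| ≤ (n + 1) ^ k * E₁ := by
    calc |∑ S ∈ low.erase ∅, a S * W S| ≤ ∑ S ∈ low.erase ∅, |a S * W S| := Finset.abs_sum_le_sum_abs _ _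
      _ ≤ ∑ S ∈ low.erase ∅, E₁ := by
          refine Finset.sum_le_sum fun S hS => ?_
          have hS' := Finset.mem_erase.1 hS
          have hcard : S.card ≤ k := by simpa [hlow] using hS'.2
          have hne : 1 ≤ S.card := Finset.card_pos.2 (Finset.nonempty_iff_ne_empty.2 hS'.1)
          rw [abs_mul]
          calc |a S| * |W S| ≤ 1 * E₁ := mul_le_mul (habs_a S) (h1 S hne hcard) (abs_nonneg _) zero_le_one
            _ = E₁ := one_mul _
      _ = (low.erase ∅).card * E₁ := by rw [Finset.sum_const, nsmul_eq_mul]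
      _ ≤ (n + 1) ^ k * E₁ := by
          refine mul_le_mul_of_nonneg_right ?_ hE₁
          have := (Finset.card_erase_le (s := low) (a := ∅)).trans (card_filter_card_le n k)
          exact_mod_cast this
  -- the tail
  have hT2 : |∑ S ∈ high, a S * W S| ≤ 2 ^ n * Real.sqrt τ := by
    have hCS := Finset.sum_mul_sq_le_sq_mul_sq high a W
    have hA : ∑ S ∈ high, a S ^ 2 ≤ τ := by
      refine le_trans (le_of_eq ?_) hτ
      rw [tailWeight]
      refine Finset.sum_congr ?_ fun _ _ => rfl
      ext S; simp only [hhigh, Finset.mem_filter, Finset.mem_univ, true_and]; omega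
    have hB : ∑ S ∈ high, W S ^ 2 ≤ (2 : ℝ) ^ n * 2 ^ n := by
      calc ∑ S ∈ high, W S ^ 2 ≤ ∑ S, W S ^ 2 :=
            Finset.sum_le_sum_of_subset_of_nonneg (Finset.subset_univ _) fun _ _ _ => sq_nonneg _
        _ = 2 ^ n * ∑ y, G y ^ 2 := sum_sq_sum_mul_walsh G
        _ ≤ 2 ^ n * ∑ _y : Fin n → Bool, (1 : ℝ) := by
            refine mul_le_mul_of_nonneg_left (Finset.sum_le_sum fun y _ => ?_) (by positivity)
            rw [← sq_abs]
            exact pow_le_one₀ (abs_nonneg _) (hG y)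
        _ = 2 ^ n * 2 ^ n := by simp
    have hτ0 : 0 ≤ τ := le_trans (Finset.sum_nonneg fun _ _ => sq_nonneg _) hA
    have hsq : (∑ S ∈ high, a S * W S) ^ 2 ≤ (2 ^ n * Real.sqrt τ) ^ 2 := by
      calc (∑ S ∈ high, a S * W S) ^ 2 ≤ (∑ S ∈ high, a S ^ 2) * ∑ S ∈ high, W S ^ 2 := hCS
        _ ≤ τ * ((2 : ℝ) ^ n * 2 ^ n) :=
            mul_le_mul hA hB (Finset.sum_nonneg fun _ _ => sq_nonneg _) hτ0
        _ = (2 ^ n * Real.sqrt τ) ^ 2 := by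
            rw [mul_pow, Real.sq_sqrt hτ0]; ring
    exact abs_le_of_sq_le_sq' hsq (by positivity) |>.elim (fun h1 h2 => abs_le.2 ⟨h1, h2⟩)
  calc |a ∅ * W ∅ + ∑ S ∈ low.erase ∅, a S * W S + ∑ S ∈ high, a S * W S|
      ≤ |a ∅ * W ∅| + |∑ S ∈ low.erase ∅, a S * W S| + |∑ S ∈ high, a S * W S| := abs_add_three _ _ _
    _ ≤ E₀ + (n + 1) ^ k * E₁ + 2 ^ n * Real.sqrt τ := by linarith

end GreenAC0

end Literature.NumberTheory.Sieve

namespace Literature.NumberTheory.Sieve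

namespace GreenAC0

open Literature.Computability.Complexity.ACForm

/-! ### The tail of an `acBasis` circuit (Tal 2017, in place of Linial–Mansour–Nisan) -/

/-- **Fourier tail of a bounded-depth circuit** (Green's Theorem 2 = Linial–Mansour–Nisan, here in
Tal's form proved in the tree): a circuit over `acBasis` with `acDepth ≤ d` and `size ≤ s`, `s ≥ 1`,
has `W^{≥k}[sgn ∘ C] ≤ tailBound (logM (2s)) (d+2) 1 k` (through the layered formula of
`Circuit.exists_acForm`, height `≤ d+1`, width `1`, effective size `≤ 2s`).
[cite: Tal2017, Theorem 3.6] [cite: Green2012, Theorem 2] -/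
theorem tailWeight_circuit_le {n : ℕ} (C : Circuit (Fin n)) (hC : C.IsOver acBasis) {d s : ℕ}
    (hd : C.acDepth ≤ d) (hs : C.size ≤ s) (hs1 : 1 ≤ s) (k : ℕ) :
    tailWeight (fun y => sgn (C.eval y)) k ≤ tailBound (logM (2 * s)) (d + 2) 1 k := by
  obtain ⟨φ, hev, hh, hw, hsize⟩ := C.exists_acForm hC
  have hfun : (fun y => sgn (C.eval y)) = sgnEval φ := by
    funext y; rw [sgnEval, hev]
  rw [hfun]
  have hM : 1 ≤ 2 * s := by omega
  exact tailWeight_le_tailBound hM (d + 2) (by omega) φ 1 le_rfl (one_le_logM hM)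
    (by omega) (hsize.trans (by omega)) hw k

/-! ### The Walsh–Liouville input (Green 2012, Proposition 1 for `λ`) -/

/-- From the Fourier–Walsh bound `|λ̂(S)| ≤ K|S|e^{-c√n/|S|}` to a bound uniform in
`1 ≤ |S| ≤ k`. [cite: Green2012, Proposition 1] -/
theorem walsh_liouville_le {c K : ℝ} (hc : 0 < c) (hK : 0 ≤ K)
    (hX : ∀ n : ℕ, 1 ≤ n → ∀ S : Finset (Fin n), S.Nonempty →
      |Literature.NumberTheory.LFunctions.walshSum (fun m => ArithmeticFunction.liouville m) S| / 2 ^ n ≤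
        K * S.card * Real.exp (-(c * Real.sqrt n / S.card)))
    {n k : ℕ} (hn : 1 ≤ n) (S : Finset (Fin n)) (h1 : 1 ≤ S.card) (hk : S.card ≤ k) :
    |∑ y : Fin n → Bool, (ArithmeticFunction.liouville (bitsToNat (List.ofFn y)) : ℝ) * walsh S y| ≤
      2 ^ n * (K * k * Real.exp (-(c * Real.sqrt n / k))) := by
  have h := hX n hn S (Finset.card_pos.1 h1)
  rw [walshSum_eq, div_le_iff₀ (by positivity)] at h
  refine h.trans ?_
  rw [mul_comm]
  refine mul_le_mul_of_nonneg_left ?_ (by positivity)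
  have hcard : (S.card : ℝ) ≤ k := by exact_mod_cast hk
  have hcard0 : (0 : ℝ) < S.card := by exact_mod_cast h1
  have hexp : Real.exp (-(c * Real.sqrt n / S.card)) ≤ Real.exp (-(c * Real.sqrt n / k)) := by
    apply Real.exp_le_exp.2
    apply neg_le_neg
    exact div_le_div_of_nonneg_left (by positivity) hcard0 hcard
  exact mul_le_mul (mul_le_mul_of_nonneg_left hcard hK) hexp (Real.exp_pos _).le (by positivity)

/-! ### The prime number theorem for `λ` along `N = 2^n` -/

/-- `∑_{x < N} F(x) = ∑_{0 < x ≤ N-1} F(x)` when `F(0) = 0`. [folklore] -/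
theorem sum_range_eq_sum_Ioc {N : ℕ} (F : ℕ → ℝ) (h0 : F 0 = 0) :
    ∑ x ∈ range N, F x = ∑ x ∈ Ioc 0 (N - 1), F x := by
  cases N with
  | zero => simp
  | succ M =>
      rw [Finset.range_eq_Ico, Finset.Ico_add_one_right_eq_Icc, Finset.Icc_eq_cons_Ioc (Nat.zero_le M),
        Finset.sum_cons, h0, zero_add]
      rfl

/-- `e^{-c√log x} ≤ η` for all large `x` (`c, η > 0`). [folklore] -/
theorem exp_neg_sqrt_log_le_eventually {c η : ℝ} (hc : 0 < c) (hη : 0 < η) :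
    ∃ X₁ : ℝ, ∀ x : ℝ, X₁ ≤ x → Real.exp (-c * Real.sqrt (Real.log x)) ≤ η := by
  set L := max (Real.log (1 / η) / c) 0 with hL
  refine ⟨Real.exp (L ^ 2), fun x hx => ?_⟩
  have hx0 : 0 < x := (Real.exp_pos _).trans_le hx
  have hlog : L ^ 2 ≤ Real.log x := by
    rw [← Real.log_exp (L ^ 2)]; exact Real.log_le_log (Real.exp_pos _) hx
  have hL0 : 0 ≤ L := le_max_right _ _
  have hsqrt : L ≤ Real.sqrt (Real.log x) := by
    rw [← Real.sqrt_sq hL0]; exact Real.sqrt_le_sqrt hlog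
  have h1 : Real.log (1 / η) / c ≤ Real.sqrt (Real.log x) := (le_max_left _ _).trans hsqrt
  rw [div_le_iff₀ hc] at h1
  have h2 : -c * Real.sqrt (Real.log x) ≤ Real.log η := by
    rw [one_div, Real.log_inv] at h1; linarith
  calc Real.exp (-c * Real.sqrt (Real.log x)) ≤ Real.exp (Real.log η) := Real.exp_le_exp.2 h2
    _ = η := Real.exp_log hη

/-- **PNT for the Liouville function along powers of two**: for `ε > 0`, eventually in `n`,
`|∑_{x < 2ⁿ} λ(x)| ≤ ε 2ⁿ` (from the tree's `∑_{n ≤ x} λ(n) ≪ x e^{-c√log x}`).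
[cite: Greaves2001, §4.5.1 (1.2)] -/
theorem abs_sum_liouville_cube_le_eventually {ε : ℝ} (hε : 0 < ε) :
    ∀ᶠ n : ℕ in atTop, |∑ y : Fin n → Bool, (ArithmeticFunction.liouville (bitsToNat (List.ofFn y)) : ℝ)| ≤ ε * 2 ^ n := by
  obtain ⟨c, hc, C, hC⟩ := Literature.NumberTheory.LFunctions.abs_sum_liouville_le_mul_exp_neg_sqrt_log
  set C' := max C 1 with hC'
  have hC'0 : 0 < C' := lt_of_lt_of_le one_pos (le_max_right _ _)
  obtain ⟨X₁, hX₁⟩ := exp_neg_sqrt_log_le_eventually hc (div_pos hε hC'0)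
  -- `2ⁿ - 1 → ∞`
  have hT : Tendsto (fun n : ℕ => (((2 ^ n - 1 : ℕ)) : ℝ)) atTop atTop :=
    tendsto_natCast_atTop_atTop.comp
      ((tendsto_sub_atTop_nat 1).comp (tendsto_pow_atTop_atTop_of_one_lt one_lt_two))
  filter_upwards [hT.eventually (eventually_ge_atTop (max X₁ 2))] with n hn
  have hx2 : (2 : ℝ) ≤ ((2 ^ n - 1 : ℕ) : ℝ) := (le_max_right _ _).trans hn
  have hxX : X₁ ≤ ((2 ^ n - 1 : ℕ) : ℝ) := (le_max_left _ _).trans hn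
  have hmain := hC _ hx2
  rw [Nat.floor_natCast] at hmain
  rw [← MoebiusWalsh.sum_range_two_pow_eq_sum_cube (fun x => (ArithmeticFunction.liouville x : ℝ)),
    sum_range_eq_sum_Ioc _ (by simp)]
  refine hmain.trans ?_
  have hexp := hX₁ _ hxX
  have hxN : ((2 ^ n - 1 : ℕ) : ℝ) ≤ 2 ^ n := by
    have : (2 ^ n - 1 : ℕ) ≤ 2 ^ n := Nat.sub_le _ _
    exact_mod_cast this
  have hx0 : (0 : ℝ) ≤ ((2 ^ n - 1 : ℕ) : ℝ) := by positivity
  calc C * ((2 ^ n - 1 : ℕ) : ℝ) * Real.exp (-c * Real.sqrt (Real.log ((2 ^ n - 1 : ℕ) : ℝ)))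
      ≤ C' * ((2 ^ n - 1 : ℕ) : ℝ) * (ε / C') := by
        refine mul_le_mul (mul_le_mul_of_nonneg_right (le_max_left _ _) hx0) hexp (Real.exp_pos _).le
          (by positivity)
    _ = ε * ((2 ^ n - 1 : ℕ) : ℝ) := by field_simp
    _ ≤ ε * 2 ^ n := mul_le_mul_of_nonneg_left hxN hε.le

/-! ### The level parameter `k ≍ n^{1/8}` -/

/-- `(Nat.sqrt (Nat.sqrt (Nat.sqrt n)))⁸ ≤ n`. [folklore] -/
theorem kk_pow_le (n : ℕ) : (Nat.sqrt (Nat.sqrt (Nat.sqrt n))) ^ 8 ≤ n := by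
  have h1 := Nat.sqrt_le' n
  have h2 := Nat.sqrt_le' (Nat.sqrt n)
  have h3 := Nat.sqrt_le' (Nat.sqrt (Nat.sqrt n))
  calc Nat.sqrt (Nat.sqrt (Nat.sqrt n)) ^ 8 = ((Nat.sqrt (Nat.sqrt (Nat.sqrt n)) ^ 2) ^ 2) ^ 2 := by ring
    _ ≤ ((Nat.sqrt (Nat.sqrt n)) ^ 2) ^ 2 := by gcongr
    _ ≤ (Nat.sqrt n) ^ 2 := by gcongr
    _ ≤ n := h1

/-- `n < (Nat.sqrt (Nat.sqrt (Nat.sqrt n)) + 1)⁸`. [folklore] -/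
theorem lt_succ_kk_pow (n : ℕ) : n < (Nat.sqrt (Nat.sqrt (Nat.sqrt n)) + 1) ^ 8 := by
  have h1 := Nat.lt_succ_sqrt' n
  have h2 := Nat.lt_succ_sqrt' (Nat.sqrt n)
  have h3 := Nat.lt_succ_sqrt' (Nat.sqrt (Nat.sqrt n))
  have h2' : Nat.sqrt n + 1 ≤ (Nat.sqrt (Nat.sqrt n) + 1) ^ 2 := h2
  have h3' : Nat.sqrt (Nat.sqrt n) + 1 ≤ (Nat.sqrt (Nat.sqrt (Nat.sqrt n)) + 1) ^ 2 := h3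
  calc n < (Nat.sqrt n + 1) ^ 2 := h1
    _ ≤ ((Nat.sqrt (Nat.sqrt n) + 1) ^ 2) ^ 2 := by gcongr
    _ ≤ (((Nat.sqrt (Nat.sqrt (Nat.sqrt n)) + 1) ^ 2) ^ 2) ^ 2 := by gcongr
    _ = (Nat.sqrt (Nat.sqrt (Nat.sqrt n)) + 1) ^ 8 := by ring

/-- `Nat.sqrt (Nat.sqrt (Nat.sqrt n)) → ∞`. [folklore] -/
theorem tendsto_kk : Tendsto (fun n : ℕ => Nat.sqrt (Nat.sqrt (Nat.sqrt n))) atTop atTop := by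
  refine tendsto_atTop_atTop.2 fun K₀ => ⟨K₀ ^ 8, fun n hn => ?_⟩
  by_contra h
  push Not at h
  have h1 : (Nat.sqrt (Nat.sqrt (Nat.sqrt n)) + 1) ^ 8 ≤ K₀ ^ 8 := Nat.pow_le_pow_left h 8
  have h2 := lt_succ_kk_pow n
  omega

/-- `⌊log₂(k+1)⌋ → ∞`. [folklore] -/
theorem tendsto_log_two_succ : Tendsto (fun k : ℕ => Nat.log 2 (k + 1)) atTop atTop := by
  refine tendsto_atTop_atTop.2 fun J => ⟨2 ^ J, fun k hk => ?_⟩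
  exact Nat.le_log_of_pow_le one_lt_two (by omega)

/-! ### The small characters: `(n+1)^k · K k e^{-c√n/k} → 0` -/

/-- With `k = Nat.sqrt (Nat.sqrt (Nat.sqrt n))`: `(n+1)^k K k e^{-c√n/k} ≤ K e^{9k² - ck³}` (`n + 1 ≤ (k+1)⁸`, `√n ≥ k⁴`).
[cite: Green2012, §2] -/
theorem low_term_le {c K : ℝ} (hc : 0 < c) (hK : 0 ≤ K) {n : ℕ} (hk : 1 ≤ Nat.sqrt (Nat.sqrt (Nat.sqrt n))) :
    ((n : ℝ) + 1) ^ Nat.sqrt (Nat.sqrt (Nat.sqrt n)) * (K * Nat.sqrt (Nat.sqrt (Nat.sqrt n)) * Real.exp (-(c * Real.sqrt n / Nat.sqrt (Nat.sqrt (Nat.sqrt n))))) ≤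
      K * Real.exp (9 * (Nat.sqrt (Nat.sqrt (Nat.sqrt n)) : ℝ) ^ 2 - c * (Nat.sqrt (Nat.sqrt (Nat.sqrt n)) : ℝ) ^ 3) := by
  set k := Nat.sqrt (Nat.sqrt (Nat.sqrt n)) with hkdef
  have hk0 : (0 : ℝ) < k := by exact_mod_cast hk
  have hk1 : (1 : ℝ) ≤ k := by exact_mod_cast hk
  -- `n + 1 ≤ (k+1)^8`
  have hn : (n : ℝ) + 1 ≤ ((k : ℝ) + 1) ^ 8 := by
    have := lt_succ_kk_pow n
    rw [← hkdef] at this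
    exact_mod_cast this
  -- `√n ≥ k^4`
  have hsqrt : (k : ℝ) ^ 4 ≤ Real.sqrt n := by
    have h8 : ((k ^ 8 : ℕ) : ℝ) ≤ n := by exact_mod_cast kk_pow_le n
    rw [show (k : ℝ) ^ 4 = Real.sqrt (((k : ℝ) ^ 4) ^ 2) by rw [Real.sqrt_sq (by positivity)]]
    refine Real.sqrt_le_sqrt ?_
    calc ((k : ℝ) ^ 4) ^ 2 = ((k ^ 8 : ℕ) : ℝ) := by push_cast; ring
      _ ≤ n := h8
  -- the exponential factor
  have hexp : Real.exp (-(c * Real.sqrt n / k)) ≤ Real.exp (-(c * (k : ℝ) ^ 3)) := by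
    apply Real.exp_le_exp.2
    apply neg_le_neg
    rw [le_div_iff₀ hk0]
    calc c * (k : ℝ) ^ 3 * k = c * (k : ℝ) ^ 4 := by ring
      _ ≤ c * Real.sqrt n := mul_le_mul_of_nonneg_left hsqrt hc.le
  -- the polynomial factor: `(n+1)^k ≤ (k+1)^{8k} = e^{8k log(k+1)} ≤ e^{8k²}`
  have hlog : Real.log ((k : ℝ) + 1) ≤ k := by
    have := Real.log_le_sub_one_of_pos (show (0 : ℝ) < k + 1 by positivity)
    linarith
  have hpoly : ((n : ℝ) + 1) ^ k ≤ Real.exp (8 * (k : ℝ) ^ 2) := by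
    calc ((n : ℝ) + 1) ^ k ≤ (((k : ℝ) + 1) ^ 8) ^ k := by gcongr
      _ = Real.exp ((8 * k) * Real.log ((k : ℝ) + 1)) := by
          rw [← Real.exp_log (show (0 : ℝ) < ((k : ℝ) + 1) ^ 8 by positivity), ← Real.exp_nat_mul,
            Real.log_pow]
          congr 1; push_cast; ring
      _ ≤ Real.exp (8 * (k : ℝ) ^ 2) := by
          apply Real.exp_le_exp.2
          calc 8 * (k : ℝ) * Real.log ((k : ℝ) + 1) ≤ 8 * k * k :=
                mul_le_mul_of_nonneg_left hlog (by positivity)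
            _ = 8 * (k : ℝ) ^ 2 := by ring
  -- `k ≤ e^{k²}`
  have hkexp : (k : ℝ) ≤ Real.exp ((k : ℝ) ^ 2) := by
    calc (k : ℝ) ≤ (k : ℝ) ^ 2 + 1 := by nlinarith
      _ ≤ Real.exp ((k : ℝ) ^ 2) := Real.add_one_le_exp _
  calc ((n : ℝ) + 1) ^ k * (K * k * Real.exp (-(c * Real.sqrt n / k)))
      ≤ Real.exp (8 * (k : ℝ) ^ 2) * (K * Real.exp ((k : ℝ) ^ 2) * Real.exp (-(c * (k : ℝ) ^ 3))) := by
        refine mul_le_mul hpoly ?_ (by positivity) (by positivity)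
        exact mul_le_mul (mul_le_mul_of_nonneg_left hkexp hK) hexp (by positivity) (by positivity)
    _ = K * Real.exp (9 * (k : ℝ) ^ 2 - c * (k : ℝ) ^ 3) := by
        rw [show 9 * (k : ℝ) ^ 2 - c * (k : ℝ) ^ 3 = 8 * (k : ℝ) ^ 2 + (k : ℝ) ^ 2 + (-(c * (k : ℝ) ^ 3)) by ring,
          Real.exp_add, Real.exp_add]
        ring

/-- Eventually in `n`, the contribution of the small characters is `≤ (ε/3) 2ⁿ`.
[cite: Green2012, §2] -/
theorem low_term_eventually {c K ε : ℝ} (hc : 0 < c) (hK : 0 ≤ K) (hε : 0 < ε) :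
    ∀ᶠ n : ℕ in atTop, ((n : ℝ) + 1) ^ Nat.sqrt (Nat.sqrt (Nat.sqrt n)) * (2 ^ n * (K * Nat.sqrt (Nat.sqrt (Nat.sqrt n)) * Real.exp (-(c * Real.sqrt n / Nat.sqrt (Nat.sqrt (Nat.sqrt n))))))
      ≤ ε / 3 * 2 ^ n := by
  -- eventually in `k`: `9k² - ck³ ≤ -k` and `K e^{-k} ≤ ε/3`
  have h1 : ∀ᶠ k : ℕ in atTop, 9 * (k : ℝ) ^ 2 - c * (k : ℝ) ^ 3 ≤ -k := by
    filter_upwards [eventually_ge_atTop (Nat.ceil (10 / c) + 1)] with k hk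
    have hk' : 10 / c ≤ k := (Nat.le_ceil _).trans (by exact_mod_cast (by omega : Nat.ceil (10 / c) ≤ k))
    have hck : 10 ≤ c * k := by rwa [div_le_iff₀ hc, mul_comm] at hk'
    have hk1 : (1 : ℝ) ≤ k := by exact_mod_cast (by omega : 1 ≤ k)
    have hk0 : (0 : ℝ) ≤ k := by linarith
    -- `ck³ ≥ 10k² ≥ 9k² + k`
    have : c * (k : ℝ) ^ 3 = (c * k) * (k : ℝ) ^ 2 := by ring
    nlinarith [mul_le_mul_of_nonneg_right hck (sq_nonneg (k : ℝ)), sq_nonneg (k : ℝ)]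
  have h2 : ∀ᶠ k : ℕ in atTop, K * Real.exp (-(k : ℝ)) ≤ ε / 3 := by
    have ht : Tendsto (fun k : ℕ => K * Real.exp (-(k : ℝ))) atTop (𝓝 (K * 0)) :=
      (Real.tendsto_exp_neg_atTop_nhds_zero.comp tendsto_natCast_atTop_atTop).const_mul K
    rw [mul_zero] at ht
    exact (ht.eventually (ge_mem_nhds (by positivity : (0 : ℝ) < ε / 3)))
  have h3 : ∀ᶠ k : ℕ in atTop, 1 ≤ k := eventually_ge_atTop 1
  filter_upwards [tendsto_kk.eventually h1, tendsto_kk.eventually h2, tendsto_kk.eventually h3]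
    with n hn1 hn2 hn3
  have hmain := low_term_le hc hK hn3
  have h2n : (0 : ℝ) < 2 ^ n := by positivity
  calc ((n : ℝ) + 1) ^ Nat.sqrt (Nat.sqrt (Nat.sqrt n)) * (2 ^ n * (K * Nat.sqrt (Nat.sqrt (Nat.sqrt n)) * Real.exp (-(c * Real.sqrt n / Nat.sqrt (Nat.sqrt (Nat.sqrt n))))))
      = 2 ^ n * (((n : ℝ) + 1) ^ Nat.sqrt (Nat.sqrt (Nat.sqrt n)) * (K * Nat.sqrt (Nat.sqrt (Nat.sqrt n)) * Real.exp (-(c * Real.sqrt n / Nat.sqrt (Nat.sqrt (Nat.sqrt n)))))) := by ring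
    _ ≤ 2 ^ n * (K * Real.exp (9 * (Nat.sqrt (Nat.sqrt (Nat.sqrt n)) : ℝ) ^ 2 - c * (Nat.sqrt (Nat.sqrt (Nat.sqrt n)) : ℝ) ^ 3)) :=
        mul_le_mul_of_nonneg_left hmain h2n.le
    _ ≤ 2 ^ n * (K * Real.exp (-(Nat.sqrt (Nat.sqrt (Nat.sqrt n)) : ℝ))) := by
        refine mul_le_mul_of_nonneg_left (mul_le_mul_of_nonneg_left (Real.exp_le_exp.2 hn1) hK) h2n.le
    _ ≤ 2 ^ n * (ε / 3) := mul_le_mul_of_nonneg_left hn2 h2n.le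
    _ = ε / 3 * 2 ^ n := by ring

end GreenAC0

end Literature.NumberTheory.Sieve

namespace Literature.NumberTheory.Sieve

namespace GreenAC0

open Literature.Computability.Complexity.ACForm

/-! ### The tail term: `tailBound (logM (2s)) (d+2) 1 (k+1) → 0` for polynomial `s` -/

/-- For `n ≥ 2 p(1) + 3`: `2 max(1, p(n)) + 1 ≤ n^{deg p + 1}`. [folklore] -/
theorem two_mul_max_eval_succ_le (p : Polynomial ℕ) {n : ℕ} (hn : 2 * p.eval 1 + 3 ≤ n) :
    2 * max 1 (p.eval n) + 1 ≤ n ^ (p.natDegree + 1) := by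
  have hn1 : 1 ≤ n := by omega
  -- `p(n) ≤ p(1) n^{deg p}` (as `natPoly_eval_le_eval_one_mul_pow` of `CircuitLowerBounds.lean`,
  -- not importable here)
  have h1 : p.eval n ≤ p.eval 1 * n ^ p.natDegree := by
    rw [Polynomial.eval_eq_sum_range, Polynomial.eval_eq_sum_range, Finset.sum_mul]
    refine Finset.sum_le_sum fun i hi => ?_
    rw [one_pow, mul_one]
    exact Nat.mul_le_mul_left _ (Nat.pow_le_pow_right hn1 (by simpa using Finset.mem_range_succ_iff.1 hi))
  have hpow : 1 ≤ n ^ p.natDegree := Nat.one_le_pow _ _ hn1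
  calc 2 * max 1 (p.eval n) + 1 ≤ 2 * (p.eval 1 * n ^ p.natDegree) + 3 := by
        rcases le_total 1 (p.eval n) with h | h
        · rw [max_eq_right h]; omega
        · rw [max_eq_left h]; omega
    _ ≤ (2 * p.eval 1 + 3) * n ^ p.natDegree := by nlinarith
    _ ≤ n * n ^ p.natDegree := Nat.mul_le_mul_right _ hn
    _ = n ^ (p.natDegree + 1) := by ring

/-- `logM (2 max(1, p(n))) ≤ 8 (deg p + 1) (log₂(Nat.sqrt (Nat.sqrt (Nat.sqrt n)) + 1) + 1)` for `n ≥ 2p(1) + 3`. [folklore] -/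
theorem logM_le (p : Polynomial ℕ) {n : ℕ} (hn : 2 * p.eval 1 + 3 ≤ n) :
    logM (2 * max 1 (p.eval n)) ≤ 8 * (p.natDegree + 1) * (Nat.log 2 (Nat.sqrt (Nat.sqrt (Nat.sqrt n)) + 1) + 1) := by
  set E := p.natDegree + 1 with hE
  set k := Nat.sqrt (Nat.sqrt (Nat.sqrt n)) with hk
  set j := Nat.log 2 (k + 1) with hj
  have hkj : k + 1 < 2 ^ (j + 1) := Nat.lt_pow_succ_log_self one_lt_two _
  have hM : 2 * max 1 (p.eval n) + 1 ≤ n ^ E := two_mul_max_eval_succ_le p hn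
  have hnk : n ^ E ≤ ((k + 1) ^ 8) ^ E := Nat.pow_le_pow_left (lt_succ_kk_pow n).le E
  have hkE : ((k + 1) ^ 8) ^ E < (2 ^ (j + 1)) ^ (8 * E) := by
    rw [← pow_mul]
    exact Nat.pow_lt_pow_left hkj (by omega)
  have hlt : 2 * max 1 (p.eval n) + 1 < 2 ^ (8 * E * (j + 1)) := by
    calc 2 * max 1 (p.eval n) + 1 ≤ ((k + 1) ^ 8) ^ E := hM.trans hnk
      _ < (2 ^ (j + 1)) ^ (8 * E) := hkE
      _ = 2 ^ (8 * E * (j + 1)) := by rw [← pow_mul]; ring_nf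
  have := (Nat.log_lt_iff_lt_pow one_lt_two (by omega)).2 hlt
  unfold logM
  omega

/-- **The Fourier tail is eventually small**: for fixed depth `d`, size polynomial `p` and
`ε > 0`, eventually `tailBound (logM (2 max(1,p(n)))) (d+2) 1 (Nat.sqrt (Nat.sqrt (Nat.sqrt n)) + 1) ≤ (ε/3)²`
(`Nat.sqrt (Nat.sqrt (Nat.sqrt n)) ≍ n^{1/8}` beats every power of `log n`). [cite: Tal2017, Theorem 3.6] [cite: Green2012, §2] -/
theorem tail_term_eventually (d : ℕ) (p : Polynomial ℕ) {ε : ℝ} (hε : 0 < ε) :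
    ∀ᶠ n : ℕ in atTop, tailBound (logM (2 * max 1 (p.eval n))) (d + 2) 1 (Nat.sqrt (Nat.sqrt (Nat.sqrt n)) + 1) ≤ (ε / 3) ^ 2 := by
  set E' : ℕ := 8 * (p.natDegree + 1) with hE'
  have hE'0 : (0 : ℝ) < E' := by rw [hE']; positivity
  set A : ℝ := (cA : ℝ) ^ (d + 2) with hA
  set B : ℝ := (cB : ℝ) ^ (d + 2) with hB
  have hA0 : 0 < A := by rw [hA]; unfold cA; positivity
  have hB0 : 0 < B := by rw [hB]; unfold cB B0; positivity
  set L : ℝ := Real.log (A / (ε / 3) ^ 2) with hL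
  -- it suffices that the exponent is eventually `≥ L`
  suffices h : ∀ᶠ n : ℕ in atTop,
      L ≤ ((Nat.sqrt (Nat.sqrt (Nat.sqrt n)) + 1 : ℕ) : ℝ) * Real.log 2 / (B * ((1 : ℕ) : ℝ) * (logM (2 * max 1 (p.eval n)) : ℝ) ^ (d + 2 - 2)) by
    filter_upwards [h] with n hn
    unfold tailBound
    have hexp := Real.exp_le_exp.2 (neg_le_neg hn)
    calc (cA : ℝ) ^ (d + 2) * Real.exp (-(((Nat.sqrt (Nat.sqrt (Nat.sqrt n)) + 1 : ℕ) : ℝ) * Real.log 2 /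
            ((cB : ℝ) ^ (d + 2) * ((1 : ℕ) : ℝ) * (logM (2 * max 1 (p.eval n)) : ℝ) ^ (d + 2 - 2))))
        ≤ A * Real.exp (-L) := mul_le_mul_of_nonneg_left hexp hA0.le
      _ = (ε / 3) ^ 2 := by
          rw [hL, Real.exp_neg, Real.exp_log (by positivity)]
          field_simp
  by_cases hL0 : L ≤ 0
  · exact Filter.Eventually.of_forall fun n => hL0.trans (by positivity)
  push Not at hL0
  set κ : ℝ := Real.log 2 / (L * B * (E' : ℝ) ^ d) with hκ
  have hl2 : 0 < Real.log 2 := Real.log_pos one_lt_two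
  have hκ0 : 0 < κ := by rw [hκ]; positivity
  -- eventually in `j`: `(j+1)^d / 2^j ≤ κ`
  have hj : ∀ᶠ j : ℕ in atTop, ((j : ℝ) + 1) ^ d / 2 ^ j ≤ κ := by
    have ht : Tendsto (fun j : ℕ => (((j + 1 : ℕ) : ℝ)) ^ d / 2 ^ (j + 1)) atTop (𝓝 0) :=
      (tendsto_pow_const_div_const_pow_of_one_lt d one_lt_two).comp (tendsto_add_atTop_nat 1)
    have ht2 := ht.const_mul 2
    rw [mul_zero] at ht2
    filter_upwards [ht2.eventually (ge_mem_nhds hκ0)] with j hj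
    calc ((j : ℝ) + 1) ^ d / 2 ^ j = 2 * ((((j + 1 : ℕ) : ℝ)) ^ d / 2 ^ (j + 1)) := by
          push_cast; rw [pow_succ]; field_simp
      _ ≤ κ := hj
  filter_upwards [(tendsto_log_two_succ.comp tendsto_kk).eventually hj,
    eventually_ge_atTop (2 * p.eval 1 + 3)] with n hjn hn
  set k := Nat.sqrt (Nat.sqrt (Nat.sqrt n)) with hk
  set j := Nat.log 2 (k + 1) with hjdef
  set ℓ := logM (2 * max 1 (p.eval n)) with hℓ
  have hjn' : ((j : ℝ) + 1) ^ d / 2 ^ j ≤ κ := hjn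
  have hℓE : ℓ ≤ E' * (j + 1) := logM_le p hn
  have hkj : 2 ^ j ≤ k + 1 := Nat.pow_log_le_self 2 (by omega)
  have hjd : ((j : ℝ) + 1) ^ d ≤ κ * 2 ^ j := by rwa [div_le_iff₀ (by positivity)] at hjn'
  have hℓ0 : (0 : ℝ) < ℓ := by
    have h1 : 1 ≤ 2 * max 1 (p.eval n) := by have := le_max_left 1 (p.eval n); omega
    exact_mod_cast one_le_logM h1
  rw [show d + 2 - 2 = d by omega, Nat.cast_one, mul_one, le_div_iff₀ (mul_pos hB0 (pow_pos hℓ0 d))]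
  calc L * (B * (ℓ : ℝ) ^ d) ≤ L * (B * ((E' : ℝ) * ((j : ℝ) + 1)) ^ d) := by
        gcongr
        exact_mod_cast hℓE
    _ = (L * B * (E' : ℝ) ^ d) * ((j : ℝ) + 1) ^ d := by rw [mul_pow]; ring
    _ ≤ (L * B * (E' : ℝ) ^ d) * (κ * 2 ^ j) := by gcongr
    _ = Real.log 2 * 2 ^ j := by rw [hκ]; field_simp
    _ ≤ Real.log 2 * ((k + 1 : ℕ) : ℝ) := by gcongr; exact_mod_cast hkj
    _ = ((k + 1 : ℕ) : ℝ) * Real.log 2 := by ring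

end GreenAC0

/-! ### Green's Theorem 1 for the Liouville function, qualitative form -/

open GreenAC0 Literature.Computability.Complexity.ACForm in
/-- **Green 2012, Theorem 1 for `λ` (qualitative), from Proposition 1 for `λ`.** The named fact
`green_liouville_AC0` follows from Green's Fourier–Walsh bound for the Liouville function
(`Literature.NumberTheory.LFunctions.green_liouville_fourierWalsh`, Green's Proposition 1 with the
printed `λ`-remark) exactly as in Green's §2: expand `∑_x λ(x)F(x)` in the Walsh basis, bound the
`≤ (n+1)^k` characters of degree `1 ≤ |S| ≤ k` (`k ≍ n^{1/8}`) by Proposition 1, the empty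
character by the prime number theorem for `λ` (tree: `abs_sum_liouville_le_mul_exp_neg_sqrt_log`),
and the tail by Cauchy–Schwarz, Parseval and the Fourier-tail bound for bounded-depth circuits
(Green's Theorem 2 = Linial–Mansour–Nisan; tree: Tal's `ACForm.tailWeight_le_tailBound` through
`Circuit.exists_acForm`, which handles `acDepth` and free negations directly).
[cite: Green2012, Theorem 1, §2 and p. 3 (Liouville remark)] -/
theorem green_liouville_AC0_of_fourierWalsh
    (hX : Literature.NumberTheory.LFunctions.green_liouville_fourierWalsh) : green_liouville_AC0 := by
  intro d p ε hε
  obtain ⟨c, hc, K, hK⟩ := hX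
  set K' := max K 0 with hK'
  have hK'0 : 0 ≤ K' := le_max_right _ _
  have hX' : ∀ n : ℕ, 1 ≤ n → ∀ S : Finset (Fin n), S.Nonempty →
      |Literature.NumberTheory.LFunctions.walshSum (fun m => ArithmeticFunction.liouville m) S| / 2 ^ n ≤
        K' * S.card * Real.exp (-(c * Real.sqrt n / S.card)) := fun n hn S hS =>
    (hK n hn S hS).trans (mul_le_mul_of_nonneg_right
      (mul_le_mul_of_nonneg_right (le_max_left _ _) (by positivity)) (Real.exp_pos _).le)
  have hε3 : 0 < ε / 3 := by positivity
  filter_upwards [abs_sum_liouville_cube_le_eventually hε3, low_term_eventually hc hK'0 hε,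
    tail_term_eventually d p hε, eventually_ge_atTop 1] with n hA hB hC hn1 C hCB hdepth hsize
  rw [MoebiusWalsh.sum_range_two_pow_eq_sum_cube
    (fun x => (ArithmeticFunction.liouville x : ℝ) * sgn (C.eval fun i => x.testBit i))]
  have hbits : ∀ y : Fin n → Bool, (fun i : Fin n => (bitsToNat (List.ofFn y)).testBit i) = y :=
    MoebiusWalsh.ofFn_testBit_bitsToNat
  simp only [hbits]
  set s := max 1 (p.eval n) with hs
  have hs1 : 1 ≤ s := le_max_left _ _
  have hsize' : C.size ≤ s := hsize.trans (le_max_right _ _)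
  have hf : ∀ y : Fin n → Bool, |sgn (C.eval y)| ≤ 1 := fun y => by
    unfold sgn; split_ifs <;> simp
  have hcore := core_bound (k := Nat.sqrt (Nat.sqrt (Nat.sqrt n))) (fun y => sgn (C.eval y))
    (fun y => (ArithmeticFunction.liouville (bitsToNat (List.ofFn y)) : ℝ)) hf
    (fun y => Literature.NumberTheory.LFunctions.LiouvilleSum.abs_liouville_le_one _)
    (E₀ := ε / 3 * 2 ^ n) (E₁ := 2 ^ n * (K' * Nat.sqrt (Nat.sqrt (Nat.sqrt n)) * Real.exp (-(c * Real.sqrt n / Nat.sqrt (Nat.sqrt (Nat.sqrt n))))))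
    (τ := tailBound (logM (2 * s)) (d + 2) 1 (Nat.sqrt (Nat.sqrt (Nat.sqrt n)) + 1))
    (by positivity) hA (fun S h1 hk => walsh_liouville_le hc hK'0 hX' hn1 S h1 hk)
    (tailWeight_circuit_le C hCB hdepth hsize' hs1 (Nat.sqrt (Nat.sqrt (Nat.sqrt n)) + 1))
  refine hcore.trans ?_
  have hsqrt : Real.sqrt (tailBound (logM (2 * s)) (d + 2) 1 (Nat.sqrt (Nat.sqrt (Nat.sqrt n)) + 1)) ≤ ε / 3 := by
    rw [← Real.sqrt_sq hε3.le]; exact Real.sqrt_le_sqrt hC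
  have h2n : (0 : ℝ) ≤ 2 ^ n := by positivity
  have := mul_le_mul_of_nonneg_left hsqrt h2n
  linarith

end Literature.NumberTheory.Sieve

end
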